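import Literature.AlgebraicGeometry.GroupSchemes.HopfIdealClosedSubgroup   -- ★ p844710 (B-p04): `isoSpecOver`, `quotIncl`, points criterion, Hopf ideal ⇒ closed subgroup
import HarnessLib

/-!
# The ideal of a closed subgroup scheme of an affine group scheme is a Hopf ideal (converse of ★ `HopfIdealClosedSubgroup`)

Layer `Literature/AlgebraicGeometry/GroupSchemes`, namespace `Literature.AlgebraicGeometry.GroupSchemes.AffineGroupScheme` (continues ★
`AffineGroupSchemeHopfAlgebra` p844646 and ★ `HopfIdealClosedSubgroup` p844710).  THEOREMS ONLY (no definition, no instance, no notation, no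
named fact, no `sorry`).  Cell `hodgecm-mathlib` (D-0151), programme P6 «MOD», organ **(o-c3m-a)** of the DICT desk F0P6c-plan (g0)
(2026-09-01 14:45Z): «THE IDEAL OF A CLOSED SUBGROUP SCHEME IS A HOPF IDEAL» — the converse of ★ `exists_grpObj_isMonHom_quotIncl` (Hopf
ideal ⇒ closed subgroup scheme) and of ★ G2 `SubgroupSchemeOfSubgroupIdeal` (p844591), i.e. the other half of «closed subgroup schemes of
`G = Spec A` ↔ Hopf ideals of `A`»; the algebra half of (o-c3m) «every closed subgroup of the connected one-dimensional layer is `ker F^j`»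
(with ★ `MonogenicLocalHopfIdeals`: the Hopf ideals ∕ coideals of `k[X]⧸(X^{p^n})` are the `(X^{p^i})`).  Count-neutral Mathlib-side
capital: HC_CM is proved only modulo the printed citations until rung 0 closes; nothing here bears on it.

THE PRINT ([Waterhouse1979] §2.1 «closed subgroups and Hopf ideals»; [GortzWedhorn2023] (27.1.1), §(27.2) p. 607; [Tate1997FiniteFlatGroupSchemes]
(3.7)).  Let `G` be an AFFINE group object of `SchemeOver R = Over (Spec R)`, `A := Alg G = Γ(G, 𝒪_G)` with its ★ Hopf structure, and
`i : K ⟶ G` a CLOSED SUBGROUP SCHEME: `K` a group object, `i` a homomorphism (`IsMonHom i`) and `i.left` a closed immersion (so `K` is affine).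
The ideal of `K` is the kernel `I` of the (surjective) algebra map `A → Alg K` of `i` — in the tree's points currency, the kernel of
`ptEquiv G (Alg K) ((isoSpecOver K).inv ≫ i)`, the algebra map of the TAUTOLOGICAL point `Spec (Alg K) ≅ K → G`.  THEN:

* §1 `ptEquiv_isoSpecOver_inv`, **`ptEquiv_isoSpecOver_inv_comp_apply`** (that algebra map IS `Γ(i) = i.left.appTop`), its SURJECTIVITY
  (`surjective_ptEquiv_isoSpecOver_inv_comp`, Mathlib `IsClosedImmersion.isAffine_surjective_of_isAffine`), `isAffine_left_of_isClosedImmersion`;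
* §2 POINTS: a point `v ≫ i` through `K` kills `I` (`le_ker_ptEquiv_comp_of_hom`), and conversely a point of `G` killing `I` factors through `i`
  (`exists_comp_eq_of_le_ker`) — so the points of `K` are EXACTLY the points of `G` killing `I`;
* §3 **`isHopfIdeal_ker_of_closedSubgroup`** — `I` IS A HOPF IDEAL (Mathlib `Ideal.IsHopfIdeal R`): `ε(I) = 0` because the unit point
  `1 = 1_K ≫ i` lies in `K`; `Δ(I) ⊆ ker (A ⊗ A → (A⧸I) ⊗ (A⧸I)) = ker (A ⊗ A → Alg K ⊗ Alg K)` because `(Γ(i) ⊗ Γ(i)) ∘ Δ` is the algebra map of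
  the point `(pr₁ ≫ i)·(pr₂ ≫ i) = (pr₁·pr₂) ≫ i` of `G` over `Spec (Alg K ⊗ Alg K)` (★ `CorepGroupLaw.mul_eq` ∕ `groupLaw_mul_apply`,
  Mathlib `MonObj.mul_comp`); `S(I) ⊆ I` because `Γ(i) ∘ S` is the algebra map of `(Spec (Alg K) → G)⁻¹ = (…)⁻¹ ≫ i` (★ `CorepGroupLaw.inv_eq`,
  Mathlib `GrpObj.inv_comp`);
* §4 **`exists_iso_comp_quotIncl_eq`** — `K ≅ Spec (A ⧸ I)` OVER `G`: an isomorphism `e : K ≅ specOver R (Alg G ⧸ I)` of `R`-schemes with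
  `e.hom ≫ quotIncl G I = i` (Mathlib `Ideal.quotientKerAlgEquivOfSurjective`), and `exists_algEquiv_quotient_ker` (`A ⧸ I ≃ₐ[R] Alg K`, whence
  the rank bookkeeping `rank K = rank_R (A ⧸ I)`).  Together with ★ `exists_grpObj_isMonHom_quotIncl`: closed subgroup schemes of `G` ↔ Hopf
  ideals of `Γ(G, 𝒪_G)`.

## References
* [Waterhouse1979] W. C. Waterhouse, *Introduction to Affine Group Schemes*, GTM 66 (1979) — §2.1 (closed subgroups and Hopf ideals).
* [GortzWedhorn2023] U. Görtz, T. Wedhorn, *Algebraic Geometry II* (2023) — (27.1.1), §(27.2) (27.2.1), p. 607.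
* [Tate1997FiniteFlatGroupSchemes] J. Tate, *Finite flat group schemes*, in: Modular Forms and Fermat's Last Theorem (1997) — (3.7).
-/

set_option autoImplicit false

-- Mathlib's `Over`/`Scheme` APIs are stated across semireducible wrappers (as in the ★ `GroupSchemes/*` files).
set_option backward.isDefEq.respectTransparency false

universe u

open CategoryTheory CategoryTheory.Limits AlgebraicGeometry MonoidalCategory CartesianMonoidalCategory TensorProduct

noncomputable section

namespace Literature.AlgebraicGeometry.GroupSchemes

namespace AffineGroupScheme

open scoped MonObj

open Literature.AlgebraicGeometry.Motives Literature.NumberTheory.DiophantineGeometry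

variable {R : Type u} [CommRing R]

/-! ## §1 The algebra map of the tautological point `Spec (Alg K) ≅ K → G` is `Γ(i)`, and it is surjective for a closed immersion -/

/-- A closed subscheme of an affine `R`-scheme is affine (Mathlib: closed immersions are affine morphisms).
[cite: GortzWedhorn2023, §(27.2) (p. 607)] -/
theorem isAffine_left_of_isClosedImmersion {K G : SchemeOver R} [IsAffine G.left] (i : K ⟶ G) [IsClosedImmersion i.left] :
    IsAffine K.left :=
  isAffine_of_isAffineHom i.left

/-- `Spec⁻¹(𝟙) = 𝟙` (Mathlib `Spec` is fully faithful). [folklore] -/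
private theorem spec_preimage_id (X : CommRingCat.{u}) : Spec.preimage (𝟙 (Spec X)) = 𝟙 X :=
  Spec.map_injective (by rw [Spec.map_preimage, Spec.map_id])

/-- The algebra map of the tautological point `Spec (Alg W) ≅ W` of an affine `R`-scheme is the identity of `Alg W`.
[cite: GortzWedhorn2023, §(27.2) (p. 606)] -/
theorem ptEquiv_isoSpecOver_inv (W : SchemeOver R) [IsAffine W.left] : ptEquiv W (Alg W) (isoSpecOver W).inv = AlgHom.id R (Alg W) := by
  have h : CommRingCat.ofHom (ptEquiv W (Alg W) (isoSpecOver W).inv).toRingHom = 𝟙 Γ(W.left, ⊤) := by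
    rw [ofHom_ptEquiv]
    change Spec.preimage (W.left.isoSpec.inv ≫ W.left.isoSpec.hom) = _
    rw [Iso.inv_hom_id, spec_preimage_id]
  exact AlgHom.ext fun a => congrArg (fun φ : Γ(W.left, ⊤) ⟶ Γ(W.left, ⊤) => φ.hom a) h

/-- **The algebra map of a composite point** `u ≫ v` (affine `W`, `G` over `R`): `(alg. map of u ≫ v)(y) = (alg. map of u)(Γ(v)(y))`
(naturality of `X ≅ Spec Γ(X)`; a private copy of ★ `ptEquiv_comp_apply` of `BTGroupConnectedDimOneCoordinates`, kept local to avoid the import).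
[cite: GortzWedhorn2023, §(27.2) (p. 606)] -/
private theorem ptEquiv_comp_apply' {W G : SchemeOver R} [IsAffine W.left] [IsAffine G.left] {R' : Type u} [CommRing R'] [Algebra R R']
    (u : specOver R R' ⟶ W) (v : W ⟶ G) (y : Alg G) : ptEquiv G R' (u ≫ v) y = ptEquiv W R' u (v.left.appTop.hom y) := by
  have h : CommRingCat.ofHom (ptEquiv G R' (u ≫ v)).toRingHom = v.left.appTop ≫ CommRingCat.ofHom (ptEquiv W R' u).toRingHom := by
    rw [ofHom_ptEquiv, ofHom_ptEquiv]
    apply Spec.map_injective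
    rw [Spec.map_preimage, Spec.map_comp, Spec.map_preimage, Over.comp_left, Category.assoc, Category.assoc,
      Scheme.isoSpec_hom_naturality]
  exact congrArg (fun φ : CommRingCat.of (Alg G) ⟶ CommRingCat.of R' => φ.hom y) h

/-- **The algebra map of the tautological point of a subscheme is `Γ(i)`**: for `i : K ⟶ G` between affine `R`-schemes,
`ptEquiv G (Alg K) ((isoSpecOver K).inv ≫ i) y = Γ(i)(y)`. [cite: GortzWedhorn2023, §(27.2) (p. 606)] -/
theorem ptEquiv_isoSpecOver_inv_comp_apply {K G : SchemeOver R} [IsAffine K.left] [IsAffine G.left] (i : K ⟶ G) (y : Alg G) :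
    ptEquiv G (Alg K) ((isoSpecOver K).inv ≫ i) y = i.left.appTop.hom y := by
  rw [ptEquiv_comp_apply', ptEquiv_isoSpecOver_inv, AlgHom.id_apply]

/-- **`Γ(i)` is surjective for a closed immersion into an affine scheme**, read on the algebra map of the tautological point.
[cite: GortzWedhorn2023, (27.1.1) and §(27.2) (p. 607)] -/
theorem surjective_ptEquiv_isoSpecOver_inv_comp {K G : SchemeOver R} [IsAffine K.left] [IsAffine G.left] (i : K ⟶ G)
    [IsClosedImmersion i.left] : Function.Surjective (ptEquiv G (Alg K) ((isoSpecOver K).inv ≫ i)) := by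
  intro y
  obtain ⟨x, hx⟩ := (IsClosedImmersion.isAffine_surjective_of_isAffine i.left).2 y
  exact ⟨x, by rw [ptEquiv_isoSpecOver_inv_comp_apply]; exact hx⟩

/-! ## §2 Points of `K` are the points of `G` killing the ideal of `K` -/

section Points

variable {K G : SchemeOver R} [IsAffine K.left] [IsAffine G.left] (i : K ⟶ G) {R' : Type u} [CommRing R'] [Algebra R R']

/-- **A point through `K` kills the ideal of `K`**: for `v : Spec R′ → K`, `ker Γ(i) ≤ ker (alg. map of v ≫ i)`.
[cite: Waterhouse1979, §2.1] [cite: GortzWedhorn2023, (27.1.1) and §(27.2) (p. 607)] -/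
theorem le_ker_ptEquiv_comp_of_hom (v : specOver R R' ⟶ K) :
    RingHom.ker (ptEquiv G (Alg K) ((isoSpecOver K).inv ≫ i)).toRingHom ≤ RingHom.ker (ptEquiv G R' (v ≫ i)).toRingHom := by
  intro a ha
  rw [RingHom.mem_ker, AlgHom.toRingHom_eq_coe, AlgHom.coe_toRingHom] at ha ⊢
  rw [ptEquiv_isoSpecOver_inv_comp_apply] at ha
  rw [ptEquiv_comp_apply', ha, map_zero]

/-- **A point of `G` killing the ideal of `K` factors through `i`** (for `i.left` a closed immersion: the algebra map factors through
`Alg G ↠ Alg G ⧸ ker Γ(i) ≅ Alg K`, Mathlib `Ideal.quotientKerAlgEquivOfSurjective`). [cite: Waterhouse1979, §2.1]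
[cite: GortzWedhorn2023, (27.1.1) and §(27.2) (p. 607)] -/
theorem exists_comp_eq_of_le_ker [IsClosedImmersion i.left] (u : specOver R R' ⟶ G)
    (h : RingHom.ker (ptEquiv G (Alg K) ((isoSpecOver K).inv ≫ i)).toRingHom ≤ RingHom.ker (ptEquiv G R' u).toRingHom) :
    ∃ v : specOver R R' ⟶ K, v ≫ i = u := by
  set iA : Alg G →ₐ[R] Alg K := ptEquiv G (Alg K) ((isoSpecOver K).inv ≫ i) with hiA
  have hsurj : Function.Surjective iA := surjective_ptEquiv_isoSpecOver_inv_comp i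
  let e : (Alg G ⧸ RingHom.ker iA) ≃ₐ[R] Alg K := Ideal.quotientKerAlgEquivOfSurjective hsurj
  let ψ : Alg K →ₐ[R] R' :=
    (Ideal.Quotient.liftₐ (RingHom.ker iA) (ptEquiv G R' u) fun a ha => h ha).comp (e.symm : Alg K →ₐ[R] Alg G ⧸ RingHom.ker iA)
  refine ⟨(ptEquiv K R').symm ψ, (ptEquiv G R').injective (AlgHom.ext fun y => ?_)⟩
  rw [ptEquiv_comp_apply', Equiv.apply_symm_apply, ← ptEquiv_isoSpecOver_inv_comp_apply i y]
  change Ideal.Quotient.liftₐ (RingHom.ker iA) (ptEquiv G R' u) (fun a ha => h ha) (e.symm (iA y)) = _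
  have hey : e.symm (iA y) = Ideal.Quotient.mk (RingHom.ker iA) y := by
    rw [AlgEquiv.symm_apply_eq, Ideal.quotientKerAlgEquivOfSurjective_mk]
  rw [hey]
  rfl

/-- **Points criterion for a closed subgroup scheme**: `u : Spec R′ → G` factors through `i : K ↪ G` iff its algebra map kills the ideal of `K`.
[cite: Waterhouse1979, §2.1] [cite: GortzWedhorn2023, (27.1.1) and §(27.2) (p. 607)] -/
theorem exists_comp_eq_iff_le_ker [IsClosedImmersion i.left] (u : specOver R R' ⟶ G) :
    (∃ v : specOver R R' ⟶ K, v ≫ i = u) ↔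
      RingHom.ker (ptEquiv G (Alg K) ((isoSpecOver K).inv ≫ i)).toRingHom ≤ RingHom.ker (ptEquiv G R' u).toRingHom := by
  constructor
  · rintro ⟨v, rfl⟩
    exact le_ker_ptEquiv_comp_of_hom i v
  · exact exists_comp_eq_of_le_ker i u

end Points

/-! ## §3 The ideal of a closed subgroup scheme is a Hopf ideal -/

section Hopf

variable {K G : SchemeOver R} [GrpObj K] [GrpObj G] [IsAffine K.left] [IsAffine G.left] (i : K ⟶ G) [IsMonHom i]

/-- `Algebra.TensorProduct.map e e` is injective for an algebra isomorphism `e` (left inverse `map e⁻¹ e⁻¹`). [folklore] -/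
private theorem map_algEquiv_injective {A B : Type u} [CommRing A] [CommRing B] [Algebra R A] [Algebra R B] (e : A ≃ₐ[R] B) :
    Function.Injective (Algebra.TensorProduct.map (e : A →ₐ[R] B) (e : A →ₐ[R] B)) := by
  intro x y hxy
  have h := congrArg (Algebra.TensorProduct.map (e.symm : B →ₐ[R] A) (e.symm : B →ₐ[R] A)) hxy
  rwa [← AlgHom.comp_apply, ← AlgHom.comp_apply, ← Algebra.TensorProduct.map_comp,
    show (e.symm : B →ₐ[R] A).comp (e : A →ₐ[R] B) = AlgHom.id R A from AlgHom.ext fun a => e.symm_apply_apply a,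
    Algebra.TensorProduct.map_id, AlgHom.id_apply, AlgHom.id_apply] at h

/-- `(Γ(i) ⊗ Γ(i)) ∘ Δ_G` is the algebra map of the point `(pr₁ ≫ i)·(pr₂ ≫ i) = (pr₁·pr₂) ≫ i` of `G` over `Spec (Alg K ⊗ Alg K)`, hence
kills the ideal of `K`. [cite: Waterhouse1979, §2.1] [cite: GortzWedhorn2023, §(27.2) (27.2.1) (p. 607)] -/
theorem map_comul_eq_zero_of_mem_ker {a : Alg G}
    (ha : a ∈ RingHom.ker (ptEquiv G (Alg K) ((isoSpecOver K).inv ≫ i)).toRingHom) :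
    Algebra.TensorProduct.map (ptEquiv G (Alg K) ((isoSpecOver K).inv ≫ i)) (ptEquiv G (Alg K) ((isoSpecOver K).inv ≫ i))
      ((groupLaw G).comul a) = 0 := by
  set uK : specOver R (Alg K) ⟶ G := (isoSpecOver K).inv ≫ i with huK
  set iA : Alg G →ₐ[R] Alg K := ptEquiv G (Alg K) uK with hiA
  -- the two points `Spec (Alg K ⊗ Alg K) ⇉ Spec (Alg K) ≅ K → G`
  let s₁ : specOver R (Alg K ⊗[R] Alg K) ⟶ specOver R (Alg K) :=
    AlgPoints.specOverMapOfAlgHom (Algebra.TensorProduct.includeLeft : Alg K →ₐ[R] Alg K ⊗[R] Alg K)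
  let s₂ : specOver R (Alg K ⊗[R] Alg K) ⟶ specOver R (Alg K) :=
    AlgPoints.specOverMapOfAlgHom (Algebra.TensorProduct.includeRight : Alg K →ₐ[R] Alg K ⊗[R] Alg K)
  have h1 : ptEquiv G _ (s₁ ≫ uK) = (Algebra.TensorProduct.includeLeft : Alg K →ₐ[R] Alg K ⊗[R] Alg K).comp iA :=
    ptEquiv_comap G _ uK
  have h2 : ptEquiv G _ (s₂ ≫ uK) = (Algebra.TensorProduct.includeRight : Alg K →ₐ[R] Alg K ⊗[R] Alg K).comp iA :=
    ptEquiv_comap G _ uK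
  -- `map iA iA = lift (ι₁ ∘ iA) (ι₂ ∘ iA)`
  have hmap : Algebra.TensorProduct.map iA iA =
      Algebra.TensorProduct.lift ((Algebra.TensorProduct.includeLeft : Alg K →ₐ[R] Alg K ⊗[R] Alg K).comp iA)
        ((Algebra.TensorProduct.includeRight : Alg K →ₐ[R] Alg K ⊗[R] Alg K).comp iA) (fun _ _ => .all _ _) := by
    refine Algebra.TensorProduct.ext' fun x y => ?_
    rw [Algebra.TensorProduct.map_tmul, Algebra.TensorProduct.lift_tmul, AlgHom.comp_apply, AlgHom.comp_apply,
      Algebra.TensorProduct.includeLeft_apply, Algebra.TensorProduct.includeRight_apply, Algebra.TensorProduct.tmul_mul_tmul,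
      mul_one, one_mul]
  rw [hmap, ← h1, ← h2, ← AlgHom.comp_apply, ← (groupLaw G).mul_eq, groupLaw_mul_apply, huK, ← Category.assoc, ← Category.assoc,
    ← MonObj.mul_comp]
  exact le_ker_ptEquiv_comp_of_hom i _ ha

/-- **THE IDEAL OF A CLOSED SUBGROUP SCHEME IS A HOPF IDEAL.**  For an affine group object `G` of `SchemeOver R` and a closed subgroup
scheme `i : K ⟶ G` (`K` a group object, `IsMonHom i`, `i.left` a closed immersion), the ideal of `K` — the kernel of the algebra map
`Γ(G) → Γ(K)` of `i`, read on the tautological point — is a Hopf ideal of the ★ Hopf algebra `Γ(G, 𝒪_G)` (Mathlib `Ideal.IsHopfIdeal`):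
`ε(I) = 0` (the unit point lies in `K`), `Δ(I) ≤ I ⊗ A + A ⊗ I` (the product of the two projections of `K × K` lies in `K`), `S(I) ≤ I`
(the inverse of the tautological point lies in `K`).  Converse of ★ `exists_grpObj_isMonHom_quotIncl`.
[cite: Waterhouse1979, §2.1] [cite: GortzWedhorn2023, (27.1.1) and §(27.2) (p. 607)] [cite: Tate1997FiniteFlatGroupSchemes, (3.7)] -/
theorem isHopfIdeal_ker_of_closedSubgroup [IsClosedImmersion i.left] :
    (RingHom.ker (ptEquiv G (Alg K) ((isoSpecOver K).inv ≫ i)).toRingHom).IsHopfIdeal R := by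
  set uK : specOver R (Alg K) ⟶ G := (isoSpecOver K).inv ≫ i with huK
  set iA : Alg G →ₐ[R] Alg K := ptEquiv G (Alg K) uK with hiA
  have hmem : ∀ {a : Alg G}, a ∈ RingHom.ker iA.toRingHom ↔ iA a = 0 := fun {a} => RingHom.mem_ker
  have hsurj : Function.Surjective iA := surjective_ptEquiv_isoSpecOver_inv_comp i
  have hco : ((RingHom.ker iA.toRingHom).restrictScalars R).IsCoideal :=
    { counit_eq_zero := fun a ha => by
        rw [Submodule.restrictScalars_mem] at ha
        -- the unit point `1 : Spec R → G` is `1_K ≫ i`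
        have h := le_ker_ptEquiv_comp_of_hom i (1 : specOver R R ⟶ K) ha
        rw [RingHom.mem_ker, AlgHom.toRingHom_eq_coe, AlgHom.coe_toRingHom, MonObj.one_comp, ← groupLaw_one, (groupLaw G).one_eq,
          AlgHom.comp_apply, Algebra.ofId_apply, Algebra.algebraMap_self, RingHom.id_apply] at h
        exact h
      map_mkQ_comul_eq_zero := fun a ha => by
        rw [Submodule.restrictScalars_mem] at ha
        -- through `(A ⧸ I) ⊗ (A ⧸ I) ≅ Alg K ⊗ Alg K` it is `(Γ(i) ⊗ Γ(i))(Δ a) = 0`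
        let e : (Alg G ⧸ RingHom.ker iA) ≃ₐ[R] Alg K := Ideal.quotientKerAlgEquivOfSurjective hsurj
        have hcomp : (Algebra.TensorProduct.map (e : _ →ₐ[R] Alg K) (e : _ →ₐ[R] Alg K)).comp
            (Algebra.TensorProduct.map (Ideal.Quotient.mkₐ R (RingHom.ker iA)) (Ideal.Quotient.mkₐ R (RingHom.ker iA))) =
            Algebra.TensorProduct.map iA iA := by
          have he : (e : _ →ₐ[R] Alg K).comp (Ideal.Quotient.mkₐ R (RingHom.ker iA)) = iA :=
            AlgHom.ext fun x => Ideal.quotientKerAlgEquivOfSurjective_mk hsurj x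
          rw [← Algebra.TensorProduct.map_comp, he]
        change Algebra.TensorProduct.map (Ideal.Quotient.mkₐ R (RingHom.ker iA)) (Ideal.Quotient.mkₐ R (RingHom.ker iA))
          ((groupLaw G).comul a) = 0
        apply map_algEquiv_injective e
        rw [← AlgHom.comp_apply, hcomp, map_zero]
        exact map_comul_eq_zero_of_mem_ker i ha }
  refine { toIsCoideal := hco, antipode_mem := fun a ha => ?_ }
  -- `Γ(i) ∘ S` is the algebra map of `uK⁻¹ = ((isoSpecOver K).inv)⁻¹ ≫ i`
  have h : iA ((groupLaw G).antipodeAlgHom a) = 0 := by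
    rw [← AlgHom.comp_apply, ← (groupLaw G).inv_eq, hiA, groupLaw_inv_apply, huK, ← GrpObj.inv_comp]
    exact le_ker_ptEquiv_comp_of_hom i _ ha
  exact h

end Hopf

/-! ## §4 `K ≅ Spec (Γ(G) ⧸ I)` over `G` -/

section IsoQuot

variable {K G : SchemeOver R} [IsAffine K.left] [IsAffine G.left] (i : K ⟶ G) [IsClosedImmersion i.left]

/-- `Γ(G) ⧸ (ideal of K) ≃ₐ[R] Γ(K)` (Mathlib `Ideal.quotientKerAlgEquivOfSurjective` for the surjection `Γ(i)`); in particular the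
`R`-rank of `K` is that of `Γ(G) ⧸ I`. [cite: Waterhouse1979, §2.1] [cite: GortzWedhorn2023, (27.1.1)] -/
theorem exists_algEquiv_quotient_ker :
    ∃ e : (Alg G ⧸ RingHom.ker (ptEquiv G (Alg K) ((isoSpecOver K).inv ≫ i)).toRingHom) ≃ₐ[R] Alg K,
      ∀ y : Alg G, e (Ideal.Quotient.mk _ y) = ptEquiv G (Alg K) ((isoSpecOver K).inv ≫ i) y :=
  ⟨Ideal.quotientKerAlgEquivOfSurjective (surjective_ptEquiv_isoSpecOver_inv_comp i),
    fun y => Ideal.quotientKerAlgEquivOfSurjective_mk _ y⟩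

/-- **`K ≅ Spec (Γ(G) ⧸ I)` OVER `G`**: the closed subscheme `i : K ↪ G` is, over `G`, the subscheme `quotIncl G I : Spec (Γ(G) ⧸ I) ↪ G`
of its ideal `I` (★ `HopfIdealClosedSubgroup.quotIncl`; with §3 and ★ `exists_grpObj_isMonHom_quotIncl`, closed subgroup schemes of `G`
↔ Hopf ideals of `Γ(G, 𝒪_G)`). [cite: Waterhouse1979, §2.1] [cite: GortzWedhorn2023, (27.1.1) and §(27.2) (p. 607)] -/
theorem exists_iso_comp_quotIncl_eq :
    ∃ e : K ≅ specOver R (Alg G ⧸ RingHom.ker (ptEquiv G (Alg K) ((isoSpecOver K).inv ≫ i)).toRingHom),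
      e.hom ≫ quotIncl G (RingHom.ker (ptEquiv G (Alg K) ((isoSpecOver K).inv ≫ i)).toRingHom) = i := by
  set uK : specOver R (Alg K) ⟶ G := (isoSpecOver K).inv ≫ i with huK
  set iA : Alg G →ₐ[R] Alg K := ptEquiv G (Alg K) uK with hiA
  have hsurj : Function.Surjective iA := surjective_ptEquiv_isoSpecOver_inv_comp i
  let e : (Alg G ⧸ RingHom.ker iA.toRingHom) ≃ₐ[R] Alg K := Ideal.quotientKerAlgEquivOfSurjective hsurj
  -- `Spec e : Spec (Alg K) ≅ Spec (Alg G ⧸ I)` over `R`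
  let f : specOver R (Alg K) ⟶ specOver R (Alg G ⧸ RingHom.ker iA.toRingHom) :=
    AlgPoints.specOverMapOfAlgHom (e : Alg G ⧸ RingHom.ker iA.toRingHom →ₐ[R] Alg K)
  let g : specOver R (Alg G ⧸ RingHom.ker iA.toRingHom) ⟶ specOver R (Alg K) :=
    AlgPoints.specOverMapOfAlgHom (e.symm : Alg K →ₐ[R] Alg G ⧸ RingHom.ker iA.toRingHom)
  have hfg : f ≫ g = 𝟙 _ := by
    apply Over.OverMorphism.ext
    rw [Over.comp_left, AlgPoints.specOverMapOfAlgHom_left, AlgPoints.specOverMapOfAlgHom_left, Over.id_left, ← Spec.map_comp,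
      ← CommRingCat.ofHom_comp, show (e : Alg G ⧸ RingHom.ker iA.toRingHom →ₐ[R] Alg K).toRingHom.comp
        (e.symm : Alg K →ₐ[R] Alg G ⧸ RingHom.ker iA.toRingHom).toRingHom = RingHom.id (Alg K) from
        RingHom.ext fun a => e.apply_symm_apply a, CommRingCat.ofHom_id]
    exact Spec.map_id _
  have hgf : g ≫ f = 𝟙 _ := by
    apply Over.OverMorphism.ext
    rw [Over.comp_left, AlgPoints.specOverMapOfAlgHom_left, AlgPoints.specOverMapOfAlgHom_left, Over.id_left, ← Spec.map_comp,
      ← CommRingCat.ofHom_comp, show (e.symm : Alg K →ₐ[R] Alg G ⧸ RingHom.ker iA.toRingHom).toRingHom.comp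
        (e : Alg G ⧸ RingHom.ker iA.toRingHom →ₐ[R] Alg K).toRingHom = RingHom.id _ from
        RingHom.ext fun a => e.symm_apply_apply a, CommRingCat.ofHom_id]
    exact Spec.map_id _
  refine ⟨(isoSpecOver K) ≪≫ ⟨f, g, hfg, hgf⟩, ?_⟩
  -- `f ≫ quotIncl = uK`: both have algebra map `e ∘ mk = iA`
  have hf : f ≫ quotIncl G (RingHom.ker iA.toRingHom) = uK := by
    apply (ptEquiv G (Alg K)).injective
    rw [ptEquiv_comap, ptEquiv_quotIncl]
    exact AlgHom.ext fun y => Ideal.quotientKerAlgEquivOfSurjective_mk hsurj y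
  rw [Iso.trans_hom, Category.assoc]
  change (isoSpecOver K).hom ≫ f ≫ quotIncl G (RingHom.ker iA.toRingHom) = i
  rw [hf, huK, Iso.hom_inv_id_assoc]

end IsoQuot

/-! ## §5 (ED. 2) The same statements keyed on `Γ(i) = i.left.appTop` (binder shape asked by the (o-c3m) consumer) -/

section AppTop

variable {K G : SchemeOver R} [IsAffine K.left] [IsAffine G.left] (i : K ⟶ G)

/-- **The ideal of `K` is `ker Γ(i)`**: the kernel of the algebra map of the tautological point equals the kernel of
`i.left.appTop : Γ(G, 𝒪_G) → Γ(K, 𝒪_K)` read on `Alg G` (§1 `ptEquiv_isoSpecOver_inv_comp_apply`). [cite: Waterhouse1979, §2.1] -/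
theorem ker_ptEquiv_isoSpecOver_inv_comp_eq :
    RingHom.ker (ptEquiv G (Alg K) ((isoSpecOver K).inv ≫ i)).toRingHom = (RingHom.ker i.left.appTop.hom : Ideal (Alg G)) := by
  ext a
  rw [RingHom.mem_ker, AlgHom.toRingHom_eq_coe, AlgHom.coe_toRingHom, ptEquiv_isoSpecOver_inv_comp_apply]
  exact Iff.rfl

/-- **`ker Γ(i)` IS A HOPF IDEAL of `Γ(G, 𝒪_G)`** (★ `Alg.instHopfAlgebra G`) for a closed subgroup scheme `i : K ⟶ G` of an affine group
scheme — `isHopfIdeal_ker_of_closedSubgroup` in the `i.left.appTop` binder shape. [cite: Waterhouse1979, §2.1]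
[cite: GortzWedhorn2023, (27.1.1) and §(27.2) (p. 607)] -/
theorem isHopfIdeal_ker_appTop [GrpObj K] [GrpObj G] [IsMonHom i] [IsClosedImmersion i.left] :
    (RingHom.ker i.left.appTop.hom : Ideal (Alg G)).IsHopfIdeal R := by
  rw [← ker_ptEquiv_isoSpecOver_inv_comp_eq]
  exact isHopfIdeal_ker_of_closedSubgroup i

/-- Points criterion in the `Γ(i)` shape: `u : Spec R′ → G` factors through `i` iff its algebra map kills `ker Γ(i)`.
[cite: Waterhouse1979, §2.1] [cite: GortzWedhorn2023, (27.1.1) and §(27.2) (p. 607)] -/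
theorem exists_comp_eq_iff_ker_appTop_le [IsClosedImmersion i.left] {R' : Type u} [CommRing R'] [Algebra R R']
    (u : specOver R R' ⟶ G) :
    (∃ v : specOver R R' ⟶ K, v ≫ i = u) ↔ (RingHom.ker i.left.appTop.hom : Ideal (Alg G)) ≤ RingHom.ker (ptEquiv G R' u).toRingHom := by
  rw [← ker_ptEquiv_isoSpecOver_inv_comp_eq]
  exact exists_comp_eq_iff_le_ker i u

/-- **`Γ(G) ⧸ ker Γ(i) ≃ₐ[R] Γ(K)`**, sending the class of `y` to `Γ(i)(y)` (Mathlib `Ideal.quotientKerAlgEquivOfSurjective`).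
[cite: Waterhouse1979, §2.1] [cite: GortzWedhorn2023, (27.1.1)] -/
theorem exists_algEquiv_quotient_ker_appTop [IsClosedImmersion i.left] :
    ∃ e : (Alg G ⧸ (RingHom.ker i.left.appTop.hom : Ideal (Alg G))) ≃ₐ[R] Alg K,
      ∀ y : Alg G, e (Ideal.Quotient.mk _ y) = i.left.appTop.hom y := by
  obtain ⟨e, he⟩ := exists_algEquiv_quotient_ker i
  refine ⟨(Ideal.quotientEquivAlgOfEq R (ker_ptEquiv_isoSpecOver_inv_comp_eq i)).symm.trans e, fun y => ?_⟩
  rw [AlgEquiv.trans_apply, ← ptEquiv_isoSpecOver_inv_comp_apply i y, ← he y]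
  rfl

/-- **`K ≅ Spec (Γ(G) ⧸ ker Γ(i))` OVER `G`** in the `Γ(i)` shape. [cite: Waterhouse1979, §2.1] [cite: GortzWedhorn2023, (27.1.1) and §(27.2) (p. 607)] -/
theorem exists_iso_comp_quotIncl_ker_appTop_eq [IsClosedImmersion i.left] :
    ∃ e : K ≅ specOver R (Alg G ⧸ (RingHom.ker i.left.appTop.hom : Ideal (Alg G))),
      e.hom ≫ quotIncl G (RingHom.ker i.left.appTop.hom : Ideal (Alg G)) = i := by
  have h := exists_iso_comp_quotIncl_eq i
  rw [ker_ptEquiv_isoSpecOver_inv_comp_eq] at h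
  exact h

end AppTop

/-! ## §6 (ED. 3) The round trip: the ideal of the closed subgroup scheme `Spec (Γ(G) ⧸ I) ↪ G` is `I` -/

section RoundTrip

variable (G : SchemeOver R) [IsAffine G.left] (I : Ideal (Alg G)) [I.IsTwoSided] [IsAffine (specOver R (Alg G ⧸ I)).left]

/-- **THE IDEAL OF `quotIncl G I : Spec (Γ(G) ⧸ I) ↪ G` IS `I`** — so «closed subschemes (subgroup schemes) of the affine `G`» ↔
«ideals (Hopf ideals) of `Γ(G, 𝒪_G)`» is a genuine BIJECTION (§3∕§4 with ★ `exists_grpObj_isMonHom_quotIncl`).  Proof by the two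
points criteria: ★ `exists_comp_quotIncl_eq_iff_le_ker` (a point factors through `quotIncl` iff it kills `I`) and §2
`exists_comp_eq_iff_le_ker` (iff it kills the ideal of the subscheme), tested at the two tautological points.  (For callers:
`haveI := isAffine_specOver_left (Alg G ⧸ I)`.) [cite: Waterhouse1979, §2.1] [cite: GortzWedhorn2023, (27.1.1) and §(27.2) (p. 607)] -/
theorem ker_ptEquiv_isoSpecOver_inv_comp_quotIncl :
    RingHom.ker (ptEquiv G (Alg (specOver R (Alg G ⧸ I)))
      ((isoSpecOver (specOver R (Alg G ⧸ I))).inv ≫ quotIncl G I)).toRingHom = I := by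
  haveI : IsClosedImmersion (quotIncl G I).left := isClosedImmersion_quotIncl_left G I
  apply le_antisymm
  · -- the tautological point `quotIncl G I` itself (algebra map `A ↠ A ⧸ I`, kernel `I`) factors through `quotIncl`
    have h := (exists_comp_eq_iff_le_ker (quotIncl G I) (quotIncl G I)).mp ⟨𝟙 _, Category.id_comp _⟩
    intro a ha
    have ha' := h ha
    rw [RingHom.mem_ker, AlgHom.toRingHom_eq_coe, AlgHom.coe_toRingHom, ptEquiv_quotIncl, Ideal.Quotient.mkₐ_eq_mk,
      Ideal.Quotient.eq_zero_iff_mem] at ha'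
    exact ha'
  · -- the tautological point of the subscheme factors through `quotIncl`, hence kills `I`
    exact (exists_comp_quotIncl_eq_iff_le_ker G I _).mp ⟨(isoSpecOver (specOver R (Alg G ⧸ I))).inv, rfl⟩

/-- The same in the `Γ`-shape: `ker Γ(quotIncl G I) = I` on `Alg G`. [cite: Waterhouse1979, §2.1] -/
theorem ker_appTop_quotIncl : (RingHom.ker (quotIncl G I).left.appTop.hom : Ideal (Alg G)) = I := by
  rw [← ker_ptEquiv_isoSpecOver_inv_comp_eq, ker_ptEquiv_isoSpecOver_inv_comp_quotIncl]

end RoundTrip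

end AffineGroupScheme

end Literature.AlgebraicGeometry.GroupSchemes

end
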